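import Literature.NumberTheory.Sieve.LinearEquationsInPrimesEnvelopingSieveMeasure
import HarnessLib

/-!
# The enveloping sieve: the linear forms condition for Green–Tao's measure (Green–Tao 2010, App. D)

Trunk T-SIEVE (`Literature/NumberTheory/Sieve`). Part of the App. D layer of the decomposition of
`Literature.NumberTheory.Sieve.GreenTaoZiegler2012_finiteComplexity`. B. Green, T. Tao, *Linear
equations in primes*, Ann. of Math. 171 (2010), App. D, proof of Prop. 6.4 (pp. 47–48 of
arXiv:math/0606088) verifies the `(D,D,D)`-linear forms condition (Def. 6.2) for the
enveloping-sieve measure `ν = ½ + ½ ν̃` of `LinearEquationsInPrimesEnvelopingSieveMeasure.lean`: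

> "Let us first verify the `(D,D,D)`-linear forms condition. By decomposing `ν` up into its
> various components as in [Green–Tao 2008], it certainly suffices to establish the somewhat general
> bound `∑_{n ∈ K ∩ ℤ^d} ∏_{j ∈ [m]} ν̃(ψ_j(n)) = vol_d(K) + o(N^d)` where `Ψ = (ψ₁,…,ψ_m)` is a
> system of affine-linear forms, no two of which are affinely related, `m, d, ‖Ψ‖_N` are all
> `O_D(1)`, and `K ⊆ [-N,N]^d` is a convex body with `Ψ(K) ⊆ [-N,N]^m`. Splitting `ν̃` up further,
> we thus reduce to showing [(D.8)]".

This file PROVES that verification relative to the display (D.8) vendored in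
`LinearEquationsInPrimesEnvelopingSieveFacts.lean`:
`Literature.NumberTheory.Sieve.GreenTao2010_envelopingSieve_linearFormsCondition_of_linearForms :
  GreenTao2010_envelopingSieve_linearForms → GreenTao2010_envelopingSieve_linearFormsCondition`.

## The argument as formalised ("decomposing `ν` up into its various components")

* On representatives, `ν(z mod N') = 1 + δ(z mod N')` with the signed weight
  `δ = ½ 1_{[1,N]} (ν̃ - 1)` (`gtDelta`, `gtMeasure_intCast`); hence
  `N'^d (𝔼 ∏ᵢ ν(ψᵢ(x)) - 1) = ∑_{∅ ≠ S ⊆ [m]} ∑_{n ∈ [0,N')^d} ∏_{i ∈ S} δ(ψᵢ(n) mod N')`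
  (`linearFormsAverage_gtMeasure_sub_one`, unwrapping `ℤ_{N'}^d` to the box, `sum_zmod_pi_eq_sum_intBox`).
* Unwrapping the values ("identify `n` with an element of `ℤ_{N'}` in the obvious manner"):
  `δ(z mod N') = ∑_{k ∈ window} δ(z - k N')` for any window of lifts containing `⌊z/N'⌋`, since
  `[1,N] ⊂ [0,N')` (`gtDelta_emod_eq_sum`); on the box the lift of a form with coefficients `≤ D`
  lies in `⌊ψ(0)/N'⌋ + [-(dD+1), dD+1]` (`ediv_mem_liftWindow`), so each subset `S` expands over
  `(2dD+3)^{|S|}` lift patterns `κ` (`sum_prod_gtDelta_eq`).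
* For one lift pattern, `∏_j δ(u_j) = 1_{all u_j ∈ [1,N]} 2^{-s} ∑_{T ⊆ S} (-1)^{s-|T|} ∏_{j ∈ T} ν̃(u_j)`
  (`prod_gtDelta_eq`) and the alternating signs cancel (`sum_powerset_neg_one_pow_compl`), leaving
  `2^{-s} ∑_T |∑_{n good} (∏_{j ∈ T} ν̃(u_j(n)) - 1)|` (`abs_sum_prod_gtDelta_le`) — the comparison of
  each weighted count with the unweighted one, the display's `vol_d(K)` serving as the common main
  term.
* The good `n ∈ [0,N')^d` are cut into cells `aN + [0,N)^d` (`sum_goodBox_eq_sum_cells`); on a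
  cell the unwrapped forms are the forms `n' ↦ ψ(aN + n') - kN'` with the same linear parts
  (`cellForm`), the good `n'` are the lattice points of a convex polytope `K_{κ,a} ⊆ [0,N-1]^d`
  (`cellBody`, `convex_cellBody`) on which these forms take values in `[1,N]`, and
  "splitting `ν̃` up further" over residue assignments `r : T → [t]` the display (D.8) at scale `N`
  gives `∑_{K_{κ,a} ∩ ℤ^d} ∏_{j ∈ T} ν̃ = vol(K_{κ,a}) + O(c^{-|T|} ε N^d)`, while
  `#(K_{κ,a} ∩ ℤ^d) = vol(K_{κ,a}) + O_d(N^{d-1})` by the lattice-point count of App. A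
  (`GreenTao2010_latticePointsConvexBody_holds`) — `abs_sum_cell_le`.
* Collecting the `2^m (2dD+3)^m (A+1)^d` pieces (`A + 1 ≤ 2C + 1` cells per direction,
  `abs_linearFormsAverage_gtMeasure_sub_one_le`) and choosing `ε` and `N₀` gives the linear forms
  condition with any error `η` (`GreenTao2010_envelopingSieve_linearFormsCondition_of_linearForms`); the
  size bound `L = L(C,D)` of the shifted systems is `abs_cellForm_const_le`.

## Rendering notes

* Def. 6.2 is used in the quantitative form of `…Pseudorandom.lean` (`LinearFormsCondition D D D η`:
  systems with the standing hypotheses of Def. 1.1, finite complexity, coefficients bounded by `D`,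
  arbitrary integer constant terms — "the error term in (6.2) is uniform over all choices of
  constant term `Ψ(0)`").
* The display (D.8) is applied at the ORIGINAL scale `N` (so that `R = N^γ` and the cutoff range
  of `w` match the measure), to the translated cells of the box `[0,N')^d`, `N' ≤ 2CN`; this is why
  the size bound `L` and the exponent threshold depend on `C` ("`γ = γ(C,D)`").

## References

* B. Green, T. Tao, *Linear equations in primes*, Ann. of Math. (2) 171 (2010), 1753–1850
  (arXiv:math/0606088): Defs. 6.1–6.2, Prop. 6.4, App. D (proof of Prop. 6.4, verification of the
  linear forms condition, display (D.8)), App. A (lattice points of convex bodies).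
* B. Green, T. Tao, *The primes contain arbitrarily long arithmetic progressions*, Ann. of
  Math. (2) 167 (2008), Prop. 9.8 (the ancestor of the decomposition of `ν`).
-/

noncomputable section

open Finset

namespace Literature.NumberTheory.Sieve

variable {t : ℕ}

/-! ### The signed weight `δ = ½ 1_{[N]} (ν̃ - 1)` on the integers -/

section Delta

variable (χ : ℝ → ℝ) (γ : ℝ) (N w : ℕ) (b : Fin t → ℕ)

/-- `δ(u) = ½ 1_{[1,N]}(u) (ν̃(u) - 1)`: on `[N] ⊂ ℤ_{N'}` Green–Tao's measure is `ν = 1 + δ`, and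
`ν = 1` off `[N]` ("By decomposing `ν` up into its various components"). [cite: GreenTao2010, App. D
(proof of Prop. 6.4, verification of the linear forms condition)] -/
def gtDelta (u : ℤ) : ℝ :=
  if 1 ≤ u ∧ u ≤ N then (gtPreMeasure χ γ N w b u - 1) / 2 else 0

variable {χ γ N w b}

/-- `ν(z mod N') = 1 + δ(z mod N')`, the residue read in `[0, N')`. [folklore] -/
theorem gtMeasure_intCast {N' : ℕ} [NeZero N'] (z : ℤ) :
    gtMeasure χ γ N w b N' (z : ZMod N') = 1 + gtDelta χ γ N w b (z % N') := by
  have hv : (((z : ZMod N').val : ℕ) : ℤ) = z % N' := ZMod.val_intCast z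
  unfold gtMeasure gtDelta
  rw [← hv]
  by_cases h : 1 ≤ (z : ZMod N').val ∧ (z : ZMod N').val ≤ N
  · rw [if_pos h, if_pos (by exact_mod_cast h)]
    ring
  · rw [if_neg h, if_neg (by exact_mod_cast h)]
    ring

/-- **Unwrapping through a window of lifts**: if `Kset ∋ ⌊z/N'⌋`, then
`δ(z mod N') = ∑_{k ∈ Kset} δ(z - k N')` — the lift `k = ⌊z/N'⌋` gives the representative, every
other lift lands outside `[0, N') ⊇ [1, N]` (`N < N'`). [cite: GreenTao2010, App. D (proof of
Prop. 6.4: "where we identify `n` with an element of `ℤ_{N'}` in the obvious manner")] -/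
theorem gtDelta_emod_eq_sum {N' : ℕ} (hNN' : N < N') (hN'0 : 0 < N') {Kset : Finset ℤ} (z : ℤ)
    (hk : z / N' ∈ Kset) :
    gtDelta χ γ N w b (z % N') = ∑ k ∈ Kset, gtDelta χ γ N w b (z - k * N') := by
  have hN'0' : (0 : ℤ) < N' := by exact_mod_cast hN'0
  rw [Finset.sum_eq_single_of_mem (z / N') hk]
  · rw [Int.emod_def]
    ring_nf
  · intro k _ hkne
    have hdec : z % N' + N' * (z / N') = z := Int.emod_add_mul_ediv z N'
    have h0 : 0 ≤ z % N' := Int.emod_nonneg z hN'0'.ne'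
    have h1 : z % N' < N' := Int.emod_lt_of_pos z hN'0'
    unfold gtDelta
    rw [if_neg]
    intro ⟨ha, hb⟩
    rcases lt_or_gt_of_ne hkne with hlt | hgt
    · -- `k < z / N'`: the lift is `≥ N' > N`
      have : (N' : ℤ) ≤ z - k * N' := by nlinarith
      omega
    · -- `k > z / N'`: the lift is `< 0`
      have : z - k * N' < 0 := by nlinarith
      omega

end Delta

/-! ### Sums over `ℤ_{N'}^d` as sums over the box `[0, N')^d` -/

/-- The integer box `[0, N')^d`. [folklore] -/
def intBox (d N' : ℕ) : Finset (Fin d → ℤ) :=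
  Fintype.piFinset fun _ : Fin d => Finset.Ico (0 : ℤ) N'

/-- Membership in the integer box. [folklore] -/
theorem mem_intBox {d N' : ℕ} {n : Fin d → ℤ} : n ∈ intBox d N' ↔ ∀ j, 0 ≤ n j ∧ n j < N' := by
  simp [intBox, Fintype.mem_piFinset]

/-- `#[0,N')^d = N'^d`. [folklore] -/
theorem card_intBox (d N' : ℕ) : #(intBox d N') = N' ^ d := by
  rw [intBox, Fintype.card_piFinset, Finset.prod_const, Finset.card_univ, Fintype.card_fin]
  simp

/-- **Unwrapping `ℤ_{N'}^d`**: a sum over `ℤ_{N'}^d` is the sum over the representatives in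
`[0, N')^d`. [folklore] -/
theorem sum_zmod_pi_eq_sum_intBox {d N' : ℕ} [NeZero N'] (F : (Fin d → ZMod N') → ℝ) :
    ∑ x, F x = ∑ n ∈ intBox d N', F (fun j => ((n j : ℤ) : ZMod N')) := by
  refine Finset.sum_nbij' (fun x => fun j => ((x j).val : ℤ)) (fun n => fun j => ((n j : ℤ) : ZMod N'))
    ?_ ?_ ?_ ?_ ?_
  · intro x _
    exact mem_intBox.mpr fun j => ⟨by positivity, by exact_mod_cast ZMod.val_lt (x j)⟩
  · intro n _; exact Finset.mem_univ _
  · intro x _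
    funext j
    simp only [Int.cast_natCast, ZMod.natCast_zmod_val]
  · intro n hn
    funext j
    obtain ⟨h0, h1⟩ := mem_intBox.mp hn j
    simp only
    rw [ZMod.val_intCast, Int.emod_eq_of_lt h0 h1]
  · intro x _
    simp only [Int.cast_natCast, ZMod.natCast_zmod_val]

/-! ### Expanding the linear forms average over subsets of forms -/

variable {χ : ℝ → ℝ} {γ : ℝ} {N w : ℕ} {b : Fin t → ℕ}

/-- **Decomposing `ν` into its components**: with `ν = 1 + δ` on representatives,
`N'^d (𝔼_{x ∈ ℤ_{N'}^d} ∏ᵢ ν(ψᵢ(x)) - 1) = ∑_{∅ ≠ S ⊆ [m]} ∑_{n ∈ [0,N')^d} ∏_{i ∈ S} δ(ψᵢ(n) mod N')`.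
[cite: GreenTao2010, App. D (proof of Prop. 6.4: "By decomposing `ν` up into its various
components")] -/
theorem linearFormsAverage_gtMeasure_sub_one {d m N' : ℕ} [NeZero N'] (Ψ : Fin m → AffLinForm d) :
    linearFormsAverage (gtMeasure χ γ N w b N') Ψ - 1 =
      (∑ S ∈ (Finset.univ : Finset (Fin m)).powerset.erase ∅,
        ∑ n ∈ intBox d N', ∏ i ∈ S, gtDelta χ γ N w b ((Ψ i).eval n % N')) / (N' : ℝ) ^ d := by
  classical
  have hN' : (N' : ℝ) ^ d ≠ 0 := pow_ne_zero _ (by exact_mod_cast NeZero.ne N')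
  unfold linearFormsAverage
  rw [sum_zmod_pi_eq_sum_intBox]
  have hterm : ∀ n ∈ intBox d N', ∏ i, gtMeasure χ γ N w b N' ((Ψ i).modEval N' (fun j => ((n j : ℤ) : ZMod N'))) =
      ∑ S ∈ (Finset.univ : Finset (Fin m)).powerset, ∏ i ∈ S, gtDelta χ γ N w b ((Ψ i).eval n % N') := by
    intro n _
    simp_rw [← AffLinForm.intCast_eval, gtMeasure_intCast]
    exact Finset.prod_one_add _
  rw [Finset.sum_congr rfl hterm, Finset.sum_comm,
    ← Finset.add_sum_erase _ _ (Finset.empty_mem_powerset _)]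
  simp only [Finset.prod_empty, Finset.sum_const, card_intBox, nsmul_eq_mul, mul_one]
  push_cast
  field_simp
  ring

/-! ### Unwrapping a family of forms through windows of lifts -/

/-- The window of lifts `⌊c/N'⌋ + [-K, K]` for a form with constant term `c`. [folklore] -/
def liftWindow (K : ℕ) (c : ℤ) (N' : ℕ) : Finset ℤ :=
  Finset.Icc (c / N' - K) (c / N' + K)

/-- `#(⌊c/N'⌋ + [-K, K]) = 2K + 1`. [folklore] -/
theorem card_liftWindow (K : ℕ) (c : ℤ) (N' : ℕ) : #(liftWindow K c N') = 2 * K + 1 := by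
  rw [liftWindow, Int.card_Icc]
  omega

/-- The linear part of a form with coefficients bounded by `D` is at most `d D M` in absolute value
on vectors with entries bounded by `M`. [folklore] -/
theorem abs_linearPart_le {d : ℕ} (ψ : AffLinForm d) {D : ℕ} (hcoeff : ∀ l, |ψ.coeff l| ≤ D)
    {M : ℤ} {n : Fin d → ℤ} (hn : ∀ j, |n j| ≤ M) :
    |ψ.linearPart n| ≤ d * D * M := by
  unfold AffLinForm.linearPart
  calc |∑ j, ψ.coeff j * n j| ≤ ∑ j, |ψ.coeff j * n j| := Finset.abs_sum_le_sum_abs _ _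
    _ ≤ ∑ j : Fin d, (D : ℤ) * M := by
        refine Finset.sum_le_sum fun j _ => ?_
        rw [abs_mul]
        exact mul_le_mul (hcoeff j) (hn j) (abs_nonneg _) (by positivity)
    _ = d * D * M := by
        rw [Finset.sum_const, Finset.card_univ, Fintype.card_fin, nsmul_eq_mul]
        ring

/-- On the box `[0, N')^d`, the lift of a form with coefficients bounded by `D` lies in the window
`⌊c/N'⌋ + [-(dD+1), dD+1]`. [folklore] -/
theorem ediv_mem_liftWindow {d N' : ℕ} (hN'0 : 0 < N') (ψ : AffLinForm d) {D : ℕ}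
    (hcoeff : ∀ l, |ψ.coeff l| ≤ D) {n : Fin d → ℤ} (hn : n ∈ intBox d N') :
    ψ.eval n / N' ∈ liftWindow (d * D + 1) ψ.const N' := by
  have hN'0' : (0 : ℤ) < N' := by exact_mod_cast hN'0
  have hlin : |ψ.linearPart n| ≤ d * D * N' := by
    refine abs_linearPart_le ψ hcoeff fun j => ?_
    obtain ⟨h0, h1⟩ := mem_intBox.mp hn j
    rw [abs_of_nonneg h0]
    exact h1.le
  rw [liftWindow, Finset.mem_Icc, AffLinForm.eval_eq_linearPart_add_const]
  obtain ⟨hl, hu⟩ := abs_le.mp hlin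
  constructor
  · have h1 : (ψ.const + (-(d * D : ℤ) - 1) * N') / N' ≤ (ψ.linearPart n + ψ.const) / N' :=
      Int.ediv_le_ediv hN'0' (by nlinarith)
    rw [Int.add_mul_ediv_right _ _ hN'0'.ne'] at h1
    push_cast
    linarith
  · have h1 : (ψ.linearPart n + ψ.const) / N' ≤ (ψ.const + (d * D : ℤ) * N') / N' :=
      Int.ediv_le_ediv hN'0' (by nlinarith)
    rw [Int.add_mul_ediv_right _ _ hN'0'.ne'] at h1
    push_cast
    linarith

/-- **Unwrapping a family of forms**: on `[0,N')^d`,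
`∏_j δ(φ_j(n) mod N') = ∑_{κ ∈ ∏_j window_j} ∏_j δ(φ_j(n) - κ_j N')` (`gtDelta_emod_eq_sum` for each
factor), hence the same for the sums over the box. [cite: GreenTao2010, App. D (proof of Prop. 6.4,
verification of the linear forms condition)] -/
theorem sum_prod_gtDelta_eq {d s N' : ℕ} (hNN' : N < N') (hN'0 : 0 < N') {D : ℕ}
    (Φ : Fin s → AffLinForm d) (hcoeff : ∀ j l, |(Φ j).coeff l| ≤ D) :
    ∑ n ∈ intBox d N', ∏ j, gtDelta χ γ N w b ((Φ j).eval n % N') =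
      ∑ κ ∈ Fintype.piFinset (fun j => liftWindow (d * D + 1) (Φ j).const N'),
        ∑ n ∈ intBox d N', ∏ j, gtDelta χ γ N w b ((Φ j).eval n - κ j * N') := by
  rw [Finset.sum_comm]
  refine Finset.sum_congr rfl fun n hn => ?_
  rw [Finset.prod_congr rfl fun j _ => gtDelta_emod_eq_sum (χ := χ) (γ := γ) (w := w) (b := b) hNN' hN'0
    ((Φ j).eval n) (ediv_mem_liftWindow hN'0 (Φ j) (hcoeff j) hn), Finset.prod_univ_sum]

/-- **Expanding the signed weights**: `∏_j δ(u_j) = 1_{all u_j ∈ [1,N]} 2^{-s} ∑_{T ⊆ [s]} (-1)^{s - |T|} ∏_{j ∈ T} ν̃(u_j)`.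
[folklore] -/
theorem prod_gtDelta_eq {s : ℕ} (u : Fin s → ℤ) :
    ∏ j, gtDelta χ γ N w b (u j) =
      if ∀ j, 1 ≤ u j ∧ u j ≤ N then
        (1 / 2) ^ s * ∑ T ∈ (Finset.univ : Finset (Fin s)).powerset,
          (-1 : ℝ) ^ (s - #T) * ∏ j ∈ T, gtPreMeasure χ γ N w b (u j)
      else 0 := by
  classical
  split_ifs with hall
  · unfold gtDelta
    rw [Finset.prod_congr rfl fun j _ => if_pos (hall j), Finset.prod_div_distrib, Finset.prod_const,
      Finset.card_univ, Fintype.card_fin, div_eq_mul_one_div, mul_comm, one_div_pow]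
    congr 1
    simp_rw [sub_eq_add_neg]
    rw [Finset.prod_add]
    refine Finset.sum_congr rfl fun T _ => ?_
    rw [Finset.prod_const, Finset.card_univ_sdiff, Fintype.card_fin, mul_comm]
  · push Not at hall
    obtain ⟨j, hj⟩ := hall
    refine Finset.prod_eq_zero (Finset.mem_univ j) ?_
    unfold gtDelta
    rw [if_neg]
    intro ⟨h1, h2⟩
    exact absurd (hj h1) (not_lt.mpr h2)

/-- The alternating signs cancel: `∑_{T ⊆ [s]} (-1)^{s - |T|} = 0` for `s ≥ 1` (the expansion of
`∏_j (1 - 1) = 0`). [folklore] -/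
theorem sum_powerset_neg_one_pow_compl {s : ℕ} (hs : 1 ≤ s) :
    ∑ T ∈ (Finset.univ : Finset (Fin s)).powerset, (-1 : ℝ) ^ (s - #T) = 0 := by
  classical
  have h := Finset.prod_add (fun _ : Fin s => (1 : ℝ)) (fun _ => (-1 : ℝ)) Finset.univ
  simp only [add_neg_cancel, Finset.prod_const_one, one_mul, Finset.prod_const, Finset.card_univ_sdiff,
    Fintype.card_fin, Finset.card_univ] at h
  rw [← h]
  exact zero_pow (by omega)

/-! ### One lift pattern: reduction to the good box -/

/-- The good part of the box for a lift pattern `κ`: the `n ∈ [0,N')^d` all of whose unwrapped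
values `φ_j(n) - κ_j N'` lie in `[1, N]`. [folklore] -/
def goodBox (d N' N : ℕ) {s : ℕ} (Φ : Fin s → AffLinForm d) (κ : Fin s → ℤ) : Finset (Fin d → ℤ) :=
  (intBox d N').filter fun n => ∀ j, 1 ≤ (Φ j).eval n - κ j * N' ∧ (Φ j).eval n - κ j * N' ≤ N

/-- **One lift pattern**: by `prod_gtDelta_eq` and the cancellation of the alternating signs,
`|∑_{n ∈ [0,N')^d} ∏_j δ(φ_j(n) - κ_j N')| ≤ 2^{-s} ∑_{T ⊆ [s]} |∑_{n good} (∏_{j ∈ T} ν̃(φ_j(n) - κ_j N') - 1)|`.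
[cite: GreenTao2010, App. D (proof of Prop. 6.4, verification of the linear forms condition)] -/
theorem abs_sum_prod_gtDelta_le {d s N' : ℕ} (hs : 1 ≤ s) (Φ : Fin s → AffLinForm d) (κ : Fin s → ℤ) :
    |∑ n ∈ intBox d N', ∏ j, gtDelta χ γ N w b ((Φ j).eval n - κ j * N')| ≤
      (1 / 2) ^ s * ∑ T ∈ (Finset.univ : Finset (Fin s)).powerset,
        |∑ n ∈ goodBox d N' N Φ κ, (∏ j ∈ T, gtPreMeasure χ γ N w b ((Φ j).eval n - κ j * N') - 1)| := by
  classical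
  set A : Finset (Fin s) → ℝ := fun T =>
    ∑ n ∈ goodBox d N' N Φ κ, ∏ j ∈ T, gtPreMeasure χ γ N w b ((Φ j).eval n - κ j * N') with hA
  -- Step 1: expand the signed weights on the good box
  have h1 : ∑ n ∈ intBox d N', ∏ j, gtDelta χ γ N w b ((Φ j).eval n - κ j * N') =
      (1 / 2) ^ s * ∑ T ∈ (Finset.univ : Finset (Fin s)).powerset, (-1 : ℝ) ^ (s - #T) * A T := by
    simp_rw [prod_gtDelta_eq (χ := χ) (γ := γ) (N := N) (w := w) (b := b) (fun j => (Φ j).eval _ - κ j * N')]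
    rw [← Finset.sum_filter, Finset.mul_sum]
    simp_rw [Finset.mul_sum]
    rw [Finset.sum_comm]
    refine Finset.sum_congr rfl fun T _ => ?_
    rw [hA]
    simp only
    rw [Finset.mul_sum, Finset.mul_sum]
    refine Finset.sum_congr rfl fun n _ => ?_
    ring
  -- Step 2: the alternating signs cancel against `A ∅`
  have h2 : ∑ T ∈ (Finset.univ : Finset (Fin s)).powerset, (-1 : ℝ) ^ (s - #T) * A T =
      ∑ T ∈ (Finset.univ : Finset (Fin s)).powerset, (-1 : ℝ) ^ (s - #T) * (A T - A ∅) := by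
    have h0 : ∑ T ∈ (Finset.univ : Finset (Fin s)).powerset, (-1 : ℝ) ^ (s - #T) * A ∅ = 0 := by
      rw [← Finset.sum_mul, sum_powerset_neg_one_pow_compl hs, zero_mul]
    rw [← sub_eq_zero, ← Finset.sum_sub_distrib, ← h0]
    refine Finset.sum_congr rfl fun T _ => ?_
    ring
  -- Step 3: `A T - A ∅ = ∑_{good} (∏_T ν̃ - 1)`
  have h3 : ∀ T, A T - A ∅ = ∑ n ∈ goodBox d N' N Φ κ,
      (∏ j ∈ T, gtPreMeasure χ γ N w b ((Φ j).eval n - κ j * N') - 1) := by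
    intro T
    rw [hA]
    simp only [Finset.prod_empty]
    rw [Finset.sum_sub_distrib]
  rw [h1, h2, abs_mul, abs_of_nonneg (by positivity : (0 : ℝ) ≤ (1 / 2) ^ s)]
  refine mul_le_mul_of_nonneg_left ((Finset.abs_sum_le_sum_abs _ _).trans (Finset.sum_le_sum fun T _ => ?_))
    (by positivity)
  rw [abs_mul, abs_pow, abs_neg, abs_one, one_pow, one_mul, h3]

/-! ### Cells of side `N` in the box `[0, N')^d` -/

/-- The number of extra cells in each direction: `A = ⌊(N'-1)/N⌋`. [folklore] -/
def cellCount (N N' : ℕ) : ℕ := (N' - 1) / N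

/-- The cell indices `a ∈ [0, A]^d`. [folklore] -/
def cellIndex (d N N' : ℕ) : Finset (Fin d → ℤ) :=
  Fintype.piFinset fun _ : Fin d => Finset.Icc (0 : ℤ) (cellCount N N')

/-- The form `n' ↦ φ(aN + n') - k N'` on the cell `aN + [0,N)^d` (same linear part, shifted constant).
[folklore] -/
def cellForm {d : ℕ} (N N' : ℕ) (ψ : AffLinForm d) (a : Fin d → ℤ) (k : ℤ) : AffLinForm d :=
  ⟨ψ.coeff, ψ.const + (N : ℤ) * ψ.linearPart a - k * N'⟩

/-- `(cellForm ψ a k)(n') = ψ(aN + n') - k N'`. [folklore] -/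
theorem cellForm_eval {d : ℕ} (N N' : ℕ) (ψ : AffLinForm d) (a : Fin d → ℤ) (k : ℤ) (n' : Fin d → ℤ) :
    (cellForm N N' ψ a k).eval n' = ψ.eval (fun j => a j * N + n' j) - k * N' := by
  simp only [cellForm, AffLinForm.eval, AffLinForm.linearPart, mul_add, Finset.sum_add_distrib,
    Finset.mul_sum]
  have : ∑ x, ψ.coeff x * (a x * (N : ℤ)) = ∑ x, (N : ℤ) * (ψ.coeff x * a x) :=
    Finset.sum_congr rfl fun x _ => by ring
  rw [this]
  ring

/-- The cell body: the part of `[0, N-1]^d` lying below `N' - 1 - aN` on which all unwrapped forms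
take values in `[1, N]` — a convex polytope. [folklore] -/
def cellBody (d N N' : ℕ) {s : ℕ} (Φ : Fin s → AffLinForm d) (κ : Fin s → ℤ) (a : Fin d → ℤ) :
    Set (Fin d → ℝ) :=
  {y | (∀ j, 0 ≤ y j ∧ y j ≤ (N : ℝ) - 1 ∧ y j + a j * N ≤ (N' : ℝ) - 1) ∧
    ∀ i, 1 ≤ (cellForm N N' (Φ i) a (κ i)).realEval y ∧ (cellForm N N' (Φ i) a (κ i)).realEval y ≤ N}

/-- A two-sided slab of an affine-linear form is convex. [folklore] -/
theorem AffLinForm.convex_slab {d : ℕ} (ψ : AffLinForm d) (lo hi : ℝ) :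
    Convex ℝ {x : Fin d → ℝ | lo ≤ ψ.realEval x ∧ ψ.realEval x ≤ hi} := by
  have h1 : {x : Fin d → ℝ | lo ≤ ψ.realEval x ∧ ψ.realEval x ≤ hi} =
      {x | lo - ψ.const ≤ ∑ j, (ψ.coeff j : ℝ) * x j} ∩ {x | ∑ j, (ψ.coeff j : ℝ) * x j ≤ hi - ψ.const} := by
    ext x
    simp only [Set.mem_setOf_eq, Set.mem_inter_iff, AffLinForm.realEval]
    constructor
    · intro ⟨h1, h2⟩; constructor <;> linarith
    · intro ⟨h1, h2⟩; constructor <;> linarith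
  rw [h1]
  exact (convex_halfSpace_ge ψ.isLinearMap_realLinearPart _).inter
    (convex_halfSpace_le ψ.isLinearMap_realLinearPart _)

/-- The cell body is convex. [folklore] -/
theorem convex_cellBody (d N N' : ℕ) {s : ℕ} (Φ : Fin s → AffLinForm d) (κ : Fin s → ℤ) (a : Fin d → ℤ) :
    Convex ℝ (cellBody d N N' Φ κ a) := by
  have h1 : cellBody d N N' Φ κ a =
      (⋂ j, {y : Fin d → ℝ | 0 ≤ y j ∧ y j ≤ (N : ℝ) - 1 ∧ y j + a j * N ≤ (N' : ℝ) - 1}) ∩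
      ⋂ i, {y | 1 ≤ (cellForm N N' (Φ i) a (κ i)).realEval y ∧ (cellForm N N' (Φ i) a (κ i)).realEval y ≤ N} := by
    ext y
    simp only [cellBody, Set.mem_setOf_eq, Set.mem_inter_iff, Set.mem_iInter]
  rw [h1]
  refine (convex_iInter fun j => ?_).inter (convex_iInter fun i => (cellForm N N' (Φ i) a (κ i)).convex_slab 1 N)
  -- coordinate constraints: a slab of the coordinate form
  have h2 : {y : Fin d → ℝ | 0 ≤ y j ∧ y j ≤ (N : ℝ) - 1 ∧ y j + a j * N ≤ (N' : ℝ) - 1} =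
      {y | 0 ≤ y j} ∩ ({y | y j ≤ (N : ℝ) - 1} ∩ {y | y j ≤ (N' : ℝ) - 1 - a j * N}) := by
    ext y
    simp only [Set.mem_setOf_eq, Set.mem_inter_iff]
    constructor
    · intro ⟨h1, h2, h3⟩; exact ⟨h1, h2, by linarith⟩
    · intro ⟨h1, h2, h3⟩; exact ⟨h1, h2, by linarith⟩
  rw [h2]
  have hlin : IsLinearMap ℝ fun y : Fin d → ℝ => y j := ⟨fun _ _ => rfl, fun _ _ => rfl⟩
  exact (convex_halfSpace_ge hlin 0).inter ((convex_halfSpace_le hlin _).inter (convex_halfSpace_le hlin _))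

/-- The cell body lies in the box `[-N, N]^d`. [folklore] -/
theorem cellBody_subset_realBox (d N N' : ℕ) {s : ℕ} (Φ : Fin s → AffLinForm d) (κ : Fin s → ℤ)
    (a : Fin d → ℤ) : cellBody d N N' Φ κ a ⊆ realBox d N := by
  intro y hy
  simp only [realBox, Set.mem_Icc]
  refine ⟨fun j => ?_, fun j => ?_⟩
  · have := (hy.1 j).1
    have hN : (0 : ℝ) ≤ N := Nat.cast_nonneg N
    linarith
  · linarith [(hy.1 j).2.1]

/-- The unwrapped forms are bounded by `N` on the cell body. [folklore] -/
theorem abs_realEval_le_of_mem_cellBody {d N N' : ℕ} {s : ℕ} {Φ : Fin s → AffLinForm d} {κ : Fin s → ℤ}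
    {a : Fin d → ℤ} {y : Fin d → ℝ} (hy : y ∈ cellBody d N N' Φ κ a) (i : Fin s) :
    |(cellForm N N' (Φ i) a (κ i)).realEval y| ≤ N := by
  obtain ⟨h1, h2⟩ := hy.2 i
  rw [abs_le]
  have hN : (0 : ℝ) ≤ N := Nat.cast_nonneg N
  constructor <;> linarith

open Classical in
/-- The lattice points of the cell body. [folklore] -/
theorem mem_filter_cellBody_iff {d N N' : ℕ} {s : ℕ} {Φ : Fin s → AffLinForm d} {κ : Fin s → ℤ}
    {a : Fin d → ℤ} {n' : Fin d → ℤ} :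
    n' ∈ (latticeBox d N).filter (fun n' => realPoint n' ∈ cellBody d N N' Φ κ a) ↔
      (∀ j, 0 ≤ n' j ∧ n' j ≤ (N : ℤ) - 1 ∧ n' j + a j * N ≤ (N' : ℤ) - 1) ∧
      ∀ i, 1 ≤ (cellForm N N' (Φ i) a (κ i)).eval n' ∧ (cellForm N N' (Φ i) a (κ i)).eval n' ≤ N := by
  rw [Finset.mem_filter]
  simp only [cellBody, Set.mem_setOf_eq, realEval_realPoint, realPoint]
  constructor
  · rintro ⟨-, h1, h2⟩
    refine ⟨fun j => ?_, fun i => ?_⟩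
    · obtain ⟨a1, a2, a3⟩ := h1 j
      exact ⟨by exact_mod_cast a1, by exact_mod_cast a2, by exact_mod_cast a3⟩
    · obtain ⟨a1, a2⟩ := h2 i
      exact ⟨by exact_mod_cast a1, by exact_mod_cast a2⟩
  · rintro ⟨h1, h2⟩
    refine ⟨?_, fun j => ?_, fun i => ?_⟩
    · unfold latticeBox
      refine Fintype.mem_piFinset.mpr fun j => Finset.mem_Icc.mpr ⟨?_, ?_⟩
      · linarith [(h1 j).1]
      · linarith [(h1 j).2.1]
    · obtain ⟨a1, a2, a3⟩ := h1 j
      exact ⟨by exact_mod_cast a1, by exact_mod_cast a2, by exact_mod_cast a3⟩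
    · obtain ⟨a1, a2⟩ := h2 i
      exact ⟨by exact_mod_cast a1, by exact_mod_cast a2⟩

open Classical in
/-- **Cutting the good box into cells**: `n = aN + n'` with `a = ⌊n/N⌋ ∈ [0, A]^d` and `n' ∈ [0,N)^d`;
the good `n` of the cell `a` are exactly the lattice points of the cell body.
[cite: GreenTao2010, App. D (proof of Prop. 6.4, verification of the linear forms condition)] -/
theorem sum_goodBox_eq_sum_cells {d s N N' : ℕ} (hN : 1 ≤ N) (hN' : 1 ≤ N') (Φ : Fin s → AffLinForm d)
    (κ : Fin s → ℤ) (G : (Fin d → ℤ) → ℝ) :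
    ∑ n ∈ goodBox d N' N Φ κ, G n =
      ∑ a ∈ cellIndex d N N', ∑ n' ∈ (latticeBox d N).filter (fun n' => realPoint n' ∈ cellBody d N N' Φ κ a),
        G (fun j => a j * N + n' j) := by
  have hN0 : (0 : ℤ) < N := by exact_mod_cast hN
  have hcc : ((cellCount N N' : ℕ) : ℤ) = ((N' : ℤ) - 1) / N := by
    rw [cellCount, Int.natCast_div, Nat.cast_sub hN']
    rfl
  -- the right-hand side as a sum over the filtered product
  have hR : ∑ a ∈ cellIndex d N N', ∑ n' ∈ (latticeBox d N).filter (fun n' => realPoint n' ∈ cellBody d N N' Φ κ a),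
      G (fun j => a j * N + n' j) =
      ∑ p ∈ ((cellIndex d N N') ×ˢ (latticeBox d N)).filter (fun p => realPoint p.2 ∈ cellBody d N N' Φ κ p.1),
        G (fun j => p.1 j * N + p.2 j) := by
    rw [Finset.sum_filter, Finset.sum_product]
    refine Finset.sum_congr rfl fun a _ => ?_
    rw [Finset.sum_filter]
  rw [hR]
  refine Finset.sum_nbij' (fun n => (fun j => n j / N, fun j => n j % N)) (fun p => fun j => p.1 j * N + p.2 j)
    ?_ ?_ ?_ ?_ ?_
  · -- into the cells
    intro n hn
    obtain ⟨hbox, hgood⟩ := Finset.mem_filter.mp hn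
    have hb : ∀ j, 0 ≤ n j ∧ n j < N' := fun j => mem_intBox.mp hbox j
    have hr : ∀ j, 0 ≤ n j % N ∧ n j % N < N := fun j =>
      ⟨Int.emod_nonneg _ hN0.ne', Int.emod_lt_of_pos _ hN0⟩
    have hq : ∀ j, 0 ≤ n j / N ∧ n j / N ≤ ((N' : ℤ) - 1) / N := fun j =>
      ⟨Int.ediv_nonneg (hb j).1 hN0.le, Int.ediv_le_ediv hN0 (by have := (hb j).2; omega)⟩
    have hdec : ∀ j, n j / N * N + n j % N = n j := fun j => Int.ediv_mul_add_emod (n j) N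
    refine Finset.mem_filter.mpr ⟨Finset.mem_product.mpr ⟨?_, ?_⟩, ?_⟩
    · unfold cellIndex
      refine Fintype.mem_piFinset.mpr fun j => Finset.mem_Icc.mpr ⟨(hq j).1, ?_⟩
      rw [hcc]; exact (hq j).2
    · unfold latticeBox
      refine Fintype.mem_piFinset.mpr fun j => Finset.mem_Icc.mpr ⟨?_, ?_⟩
      · linarith [(hr j).1]
      · linarith [(hr j).2]
    · have hfun : (fun j => n j / (N : ℤ) * N + n j % N) = n := funext hdec
      have hmem := (mem_filter_cellBody_iff (N := N) (N' := N') (Φ := Φ) (κ := κ) (a := fun j => n j / N)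
        (n' := fun j => n j % N)).mpr
        ⟨fun j => ⟨(hr j).1, by linarith [(hr j).2], by
          show n j % (N : ℤ) + n j / N * N ≤ (N' : ℤ) - 1
          linarith [hdec j, (hb j).2]⟩,
         fun i => by
          rw [cellForm_eval]
          show 1 ≤ (Φ i).eval (fun j => n j / (N : ℤ) * N + n j % N) - κ i * N' ∧
            (Φ i).eval (fun j => n j / (N : ℤ) * N + n j % N) - κ i * N' ≤ N
          rw [hfun]
          exact hgood i⟩
      exact (Finset.mem_filter.mp hmem).2
  · -- from the cells
    intro p hp
    obtain ⟨hp1, hp2⟩ := Finset.mem_filter.mp hp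
    obtain ⟨ha, -⟩ := Finset.mem_product.mp hp1
    have hmem := (mem_filter_cellBody_iff (N := N) (N' := N') (Φ := Φ) (κ := κ) (a := p.1) (n' := p.2)).mp
      (Finset.mem_filter.mpr ⟨(Finset.mem_product.mp hp1).2, hp2⟩)
    obtain ⟨hc, hf⟩ := hmem
    have ha' : ∀ j, 0 ≤ p.1 j := fun j => by
      unfold cellIndex at ha
      exact (Finset.mem_Icc.mp (Fintype.mem_piFinset.mp ha j)).1
    refine Finset.mem_filter.mpr ⟨mem_intBox.mpr fun j => ⟨?_, ?_⟩, fun i => ?_⟩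
    · have := (hc j).1; have := ha' j; positivity
    · linarith [(hc j).2.2]
    · have := hf i
      rw [cellForm_eval] at this
      exact this
  · -- left inverse
    intro n _
    funext j
    exact Int.ediv_mul_add_emod (n j) N
  · -- right inverse
    intro p hp
    obtain ⟨hp1, hp2⟩ := Finset.mem_filter.mp hp
    have hmem := (mem_filter_cellBody_iff (N := N) (N' := N') (Φ := Φ) (κ := κ) (a := p.1) (n' := p.2)).mp
      (Finset.mem_filter.mpr ⟨(Finset.mem_product.mp hp1).2, hp2⟩)
    obtain ⟨hc, -⟩ := hmem
    have h0 : ∀ j, 0 ≤ p.2 j ∧ p.2 j < N := fun j => ⟨(hc j).1, by linarith [(hc j).2.1]⟩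
    refine Prod.ext (funext fun j => ?_) (funext fun j => ?_)
    · show (p.1 j * N + p.2 j) / N = p.1 j
      rw [add_comm, Int.add_mul_ediv_right _ _ hN0.ne', Int.ediv_eq_zero_of_lt (h0 j).1 (h0 j).2, zero_add]
    · show (p.1 j * N + p.2 j) % N = p.2 j
      rw [add_comm, Int.add_mul_emod_self_right, Int.emod_eq_of_lt (h0 j).1 (h0 j).2]
  · -- the summand
    intro n _
    congr 1
    funext j
    exact (Int.ediv_mul_add_emod (n j) N).symm

/-! ### One cell: the linear forms display -/

/-- `ν̃(y) = K ∑ᵢ Λ_{χ,R,2}(Wy + bᵢ)` with `K = (φ(W)/W)/(t c)`: products of `ν̃` over `s` arguments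
expand over residue assignments `r : [s] → [t]` ("Splitting `ν̃` up further"). [cite: GreenTao2010,
App. D (proof of Prop. 6.4: "Splitting `ν̃` up further, we thus reduce to showing (D.8) for all
`i₁, …, i_m ∈ [t]`")] -/
theorem prod_gtPreMeasure_eq {s : ℕ} (y : Fin s → ℤ) :
    ∏ j, gtPreMeasure χ γ N w b (y j) =
      ((Nat.totient (primorial w) : ℝ) / primorial w / (t * GreenTao2008.cChi χ)) ^ s *
        ∑ r ∈ Fintype.piFinset (fun _ : Fin s => (Finset.univ : Finset (Fin t))),
          ∏ j, truncDivisorSum χ ((N : ℝ) ^ γ) 2 ((primorial w : ℤ) * y j + b (r j)) := by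
  classical
  unfold gtPreMeasure
  rw [Finset.prod_mul_distrib, Finset.prod_const, Finset.card_univ, Fintype.card_fin,
    Finset.prod_univ_sum]

/-- Products over a subset reindexed by its increasing enumeration. [folklore] -/
theorem prod_eq_prod_orderEmbOfFin {m : ℕ} (S : Finset (Fin m)) {s : ℕ} (hS : S.card = s) (f : Fin m → ℝ) :
    ∏ i ∈ S, f i = ∏ j : Fin s, f (S.orderEmbOfFin hS j) := by
  have h := Finset.prod_map (Finset.univ : Finset (Fin s)) (S.orderEmbOfFin hS).toEmbedding f
  rw [Finset.map_orderEmbOfFin_univ S hS] at h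
  rw [h]
  rfl

open Classical in
/-- The conclusion of the linear forms display `GreenTao2010_envelopingSieve_linearForms` with
dimension and number of forms at most `D`, size bound `L`, at cutoff `χ`, exponent `γ`, scale `N`,
cutoff `w` and error `ε` (the tail of that fact after its thresholds). [cite: GreenTao2010, App. D
(proof of Prop. 6.4, display (D.8))] -/
def LinFormsEstimateAt (χ : ℝ → ℝ) (γ : ℝ) (N w D L : ℕ) (ε : ℝ) : Prop :=
  ∀ (d m : ℕ), 1 ≤ d → d ≤ D → 1 ≤ m → m ≤ D →
    ∀ b : Fin m → ℕ, (∀ j, 1 ≤ b j ∧ b j ≤ primorial w ∧ Nat.Coprime (b j) (primorial w)) →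
    ∀ Ψ : Fin m → AffLinForm d, IsNondegenerateSystem Ψ → IsFiniteComplexitySystem Ψ →
      affLinSize Ψ N ≤ L →
    ∀ K : Set (Fin d → ℝ), Convex ℝ K → K ⊆ realBox d N →
      (∀ x ∈ K, ∀ j, |(Ψ j).realEval x| ≤ N) →
      |((Nat.totient (primorial w) : ℝ) / primorial w) ^ m *
          ∑ n ∈ (latticeBox d N).filter (fun n => realPoint n ∈ K),
            ∏ j, truncDivisorSum χ ((N : ℝ) ^ γ) 2 ((primorial w : ℤ) * (Ψ j).eval n + b j) -
        GreenTao2008.cChi χ ^ m * (MeasureTheory.volume K).toReal| ≤ ε * (N : ℝ) ^ d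

/-- The linear forms display supplies `LinFormsEstimateAt` past its thresholds. [cite: GreenTao2010,
App. D (proof of Prop. 6.4, display (D.8))] -/
theorem linFormsEstimateAt_of_linearForms (hF : GreenTao2010_envelopingSieve_linearForms) (D L : ℕ)
    {χ : ℝ → ℝ} (hχ : IsSmoothCompactCutoff χ) :
    ∃ γ₀ : ℝ, 0 < γ₀ ∧ ∀ γ : ℝ, 0 < γ → γ ≤ γ₀ → ∀ ε : ℝ, 0 < ε → ∃ w₀ N₀ : ℕ,
      ∀ N : ℕ, N₀ ≤ N → ∀ w : ℕ, w₀ ≤ w → (w : ℝ) ≤ Real.log (Real.log N) / 2 →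
        LinFormsEstimateAt χ γ N w D L ε := by
  obtain ⟨γ₀, hγ₀, H⟩ := hF D L χ hχ
  refine ⟨γ₀, hγ₀, fun γ hγ hγle ε hε => ?_⟩
  obtain ⟨w₀, N₀, H'⟩ := H γ hγ hγle ε hε
  exact ⟨w₀, N₀, fun N hN w hw hwN d m hd hdD hm hmD b hb Ψ hnd hfc hsize K hK hKb hbdd =>
    H' N hN w hw hwN d m hd hdD hm hmD b hb Ψ hnd hfc hsize K hK hKb hbdd⟩

open Classical in
/-- **One cell** (`T ≠ ∅` weight factors among `s` unwrapped forms, on the cell `aN + [0,N)^d`):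
reindexing `T`, splitting `ν̃` over residue assignments and applying the linear forms display to the
shifted forms on the cell body, together with the lattice-point count of the cell body,
`|∑_{n' ∈ body ∩ ℤ^d} (∏_{j ∈ T} ν̃(φ^{κ,a}_j(n')) - 1)| ≤ c^{-|T|} ε N^d + C_d N^{d-1}`.
[cite: GreenTao2010, App. D (proof of Prop. 6.4, display (D.8) and the sentence following it)] -/
theorem abs_sum_cell_le {d s D L Lc N' : ℕ} (hd : 1 ≤ d) (hdD : d ≤ D) (ht : 1 ≤ t)
    (hc : 0 < GreenTao2008.cChi χ) (hN : 1 ≤ N)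
    (hb : ∀ i, 1 ≤ b i ∧ b i ≤ primorial w ∧ Nat.Coprime (b i) (primorial w))
    (Φ : Fin s → AffLinForm d) (hcoeff0 : ∀ j, (Φ j).coeff ≠ 0) (hfc : IsFiniteComplexitySystem Φ)
    (hcoeff : ∀ j l, |(Φ j).coeff l| ≤ D) (κ : Fin s → ℤ) (a : Fin d → ℤ)
    (hconst : ∀ j, |(((cellForm N N' (Φ j) a (κ j)).const : ℤ) : ℝ)| ≤ Lc * N)
    (hL : D ^ 3 + D * Lc ≤ L) {ε : ℝ} (hF : LinFormsEstimateAt χ γ N w D L ε)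
    {Cl : ℝ} (hLatt : ∀ K : Set (Fin d → ℝ), Convex ℝ K → K ⊆ realBox d N →
      |(#((latticeBox d N).filter fun n => realPoint n ∈ K) : ℝ) - (MeasureTheory.volume K).toReal| ≤
        Cl * (N : ℝ) ^ (d - 1))
    (T : Finset (Fin s)) (hT : T.Nonempty) (hTD : #T ≤ D) :
    |∑ n' ∈ (latticeBox d N).filter (fun n' => realPoint n' ∈ cellBody d N N' Φ κ a),
        (∏ j ∈ T, gtPreMeasure χ γ N w b ((cellForm N N' (Φ j) a (κ j)).eval n') - 1)| ≤
      (1 / GreenTao2008.cChi χ) ^ #T * ε * (N : ℝ) ^ d + Cl * (N : ℝ) ^ (d - 1) := by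
  set K : Set (Fin d → ℝ) := cellBody d N N' Φ κ a with hK
  set P : Finset (Fin d → ℤ) := (latticeBox d N).filter (fun n' => realPoint n' ∈ K) with hP
  set t' : ℕ := #T with ht'
  have ht'1 : 1 ≤ t' := Finset.card_pos.mpr hT
  set τ := T.orderEmbOfFin rfl with hτ
  set Φ' : Fin t' → AffLinForm d := fun j' => cellForm N N' (Φ (τ j')) a (κ (τ j')) with hΦ'
  set c : ℝ := GreenTao2008.cChi χ with hcdef
  have hc0 : 0 < c := hc
  have hc' : c ≠ 0 := hc.ne'
  have ht0 : (0 : ℝ) < t := by exact_mod_cast ht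
  have hN1 : (1 : ℝ) ≤ N := by exact_mod_cast hN
  set φW : ℝ := (Nat.totient (primorial w) : ℝ) / primorial w with hφW
  set V : ℝ := (MeasureTheory.volume K).toReal with hV
  -- the hypotheses of the display for the reindexed shifted family
  have hfc' : IsFiniteComplexitySystem Φ' := fun j j' hjj' A B hAB =>
    hfc (τ j) (τ j') (fun h => hjj' (τ.injective h)) A B hAB
  have hnd' : IsNondegenerateSystem Φ' := hfc'.isNondegenerateSystem fun j' => hcoeff0 (τ j')
  have hsize' : affLinSize Φ' N ≤ L := by
    unfold affLinSize
    have h1 : ∀ j' : Fin t', ∑ l, |((Φ' j').coeff l : ℝ)| ≤ d * D := by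
      intro j'
      calc ∑ l, |((Φ' j').coeff l : ℝ)| ≤ ∑ l : Fin d, (D : ℝ) :=
            Finset.sum_le_sum fun l _ => by exact_mod_cast hcoeff (τ j') l
        _ = d * D := by rw [Finset.sum_const, Finset.card_univ, Fintype.card_fin, nsmul_eq_mul]
    have h2 : ∀ j' : Fin t', |((Φ' j').const : ℝ) / N| ≤ Lc := by
      intro j'
      rw [abs_div, abs_of_pos (by linarith : (0 : ℝ) < N), div_le_iff₀ (by linarith)]
      exact hconst (τ j')
    have h3 : (t' : ℝ) ≤ D := by exact_mod_cast hTD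
    have h4 : (d : ℝ) ≤ D := by exact_mod_cast hdD
    calc ∑ j', ∑ l, |((Φ' j').coeff l : ℝ)| + ∑ j', |((Φ' j').const : ℝ) / N|
        ≤ ∑ j' : Fin t', (d : ℝ) * D + ∑ j' : Fin t', (Lc : ℝ) :=
          add_le_add (Finset.sum_le_sum fun j' _ => h1 j') (Finset.sum_le_sum fun j' _ => h2 j')
      _ = t' * (d * D) + t' * Lc := by
          rw [Finset.sum_const, Finset.sum_const, Finset.card_univ, Fintype.card_fin, nsmul_eq_mul, nsmul_eq_mul]
      _ ≤ D * (D * D) + D * Lc := by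
          have hLc : (0 : ℝ) ≤ Lc := Nat.cast_nonneg Lc
          have hD0 : (0 : ℝ) ≤ D := Nat.cast_nonneg D
          have e1 : (t' : ℝ) * (d * D) ≤ D * (D * D) :=
            mul_le_mul h3 (mul_le_mul_of_nonneg_right h4 hD0) (by positivity) hD0
          have e2 : (t' : ℝ) * Lc ≤ D * Lc := mul_le_mul_of_nonneg_right h3 hLc
          linarith
      _ ≤ L := by
          have h5 : ((D ^ 3 + D * Lc : ℕ) : ℝ) ≤ L := by exact_mod_cast hL
          push_cast at h5
          have h6 : (D : ℝ) ^ 3 = D * (D * D) := by ring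
          linarith
  have hKconv : Convex ℝ K := convex_cellBody d N N' Φ κ a
  have hKbox : K ⊆ realBox d N := cellBody_subset_realBox d N N' Φ κ a
  have hKbdd : ∀ x ∈ K, ∀ j', |(Φ' j').realEval x| ≤ N := fun x hx j' =>
    abs_realEval_le_of_mem_cellBody hx (τ j')
  -- Step 1: the weighted sum minus the volume
  have hdisp : ∀ r ∈ Fintype.piFinset (fun _ : Fin t' => (Finset.univ : Finset (Fin t))),
      |φW ^ t' * ∑ n' ∈ P, ∏ j', truncDivisorSum χ ((N : ℝ) ^ γ) 2 ((primorial w : ℤ) * (Φ' j').eval n' + b (r j')) -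
        c ^ t' * V| ≤ ε * (N : ℝ) ^ d :=
    fun r _ => hF d t' hd hdD ht'1 (hTD) (fun j' => b (r j')) (fun j' => hb (r j')) Φ' hnd' hfc' hsize' K
      hKconv hKbox hKbdd
  have hsum1 : ∑ n' ∈ P, ∏ j ∈ T, gtPreMeasure χ γ N w b ((cellForm N N' (Φ j) a (κ j)).eval n') =
      (φW / (t * c)) ^ t' * ∑ r ∈ Fintype.piFinset (fun _ : Fin t' => (Finset.univ : Finset (Fin t))),
        ∑ n' ∈ P, ∏ j', truncDivisorSum χ ((N : ℝ) ^ γ) 2 ((primorial w : ℤ) * (Φ' j').eval n' + b (r j')) := by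
    rw [Finset.sum_congr rfl fun n' _ => prod_eq_prod_orderEmbOfFin T rfl
      (fun j => gtPreMeasure χ γ N w b ((cellForm N N' (Φ j) a (κ j)).eval n'))]
    simp_rw [prod_gtPreMeasure_eq]
    rw [← Finset.mul_sum, Finset.sum_comm]
  have hV2 : V = (1 / (t * c)) ^ t' *
      ∑ r ∈ Fintype.piFinset (fun _ : Fin t' => (Finset.univ : Finset (Fin t))), c ^ t' * V := by
    rw [Finset.sum_const, Fintype.card_piFinset_const, Finset.card_univ, Fintype.card_fin, nsmul_eq_mul]
    push_cast
    have : (1 / ((t : ℝ) * c)) ^ t' * (t : ℝ) ^ t' * c ^ t' = 1 := by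
      rw [← mul_pow, ← mul_pow]
      have : 1 / ((t : ℝ) * c) * t * c = 1 := by field_simp
      rw [this, one_pow]
    calc V = ((1 / ((t : ℝ) * c)) ^ t' * (t : ℝ) ^ t' * c ^ t') * V := by rw [this, one_mul]
      _ = (1 / (t * c)) ^ t' * ((t : ℝ) ^ t' * (c ^ t' * V)) := by ring
  have hstep1 : |∑ n' ∈ P, ∏ j ∈ T, gtPreMeasure χ γ N w b ((cellForm N N' (Φ j) a (κ j)).eval n') - V| ≤
      (1 / c) ^ t' * ε * (N : ℝ) ^ d := by
    have hkey : ∑ n' ∈ P, ∏ j ∈ T, gtPreMeasure χ γ N w b ((cellForm N N' (Φ j) a (κ j)).eval n') - V =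
        (1 / (t * c)) ^ t' * ∑ r ∈ Fintype.piFinset (fun _ : Fin t' => (Finset.univ : Finset (Fin t))),
          (φW ^ t' * ∑ n' ∈ P, ∏ j', truncDivisorSum χ ((N : ℝ) ^ γ) 2 ((primorial w : ℤ) * (Φ' j').eval n' + b (r j')) -
            c ^ t' * V) := by
      rw [hsum1, Finset.sum_sub_distrib, mul_sub, ← hV2]
      congr 1
      rw [Finset.mul_sum, Finset.mul_sum]
      refine Finset.sum_congr rfl fun r _ => ?_
      rw [div_eq_mul_one_div φW, mul_pow]
      ring
    rw [hkey, abs_mul, abs_of_nonneg (by positivity : (0 : ℝ) ≤ (1 / (t * c)) ^ t')]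
    calc (1 / ((t : ℝ) * c)) ^ t' * |∑ r ∈ Fintype.piFinset (fun _ : Fin t' => (Finset.univ : Finset (Fin t))),
          (φW ^ t' * ∑ n' ∈ P, ∏ j', truncDivisorSum χ ((N : ℝ) ^ γ) 2 ((primorial w : ℤ) * (Φ' j').eval n' + b (r j')) -
            c ^ t' * V)|
        ≤ (1 / ((t : ℝ) * c)) ^ t' * ∑ r ∈ Fintype.piFinset (fun _ : Fin t' => (Finset.univ : Finset (Fin t))),
            ε * (N : ℝ) ^ d := by
          refine mul_le_mul_of_nonneg_left ((Finset.abs_sum_le_sum_abs _ _).trans (Finset.sum_le_sum hdisp))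
            (by positivity)
      _ = (1 / c) ^ t' * ε * (N : ℝ) ^ d := by
          rw [Finset.sum_const, Fintype.card_piFinset_const, Finset.card_univ, Fintype.card_fin, nsmul_eq_mul]
          push_cast
          have : (1 / ((t : ℝ) * c)) ^ t' * (t : ℝ) ^ t' = (1 / c) ^ t' := by
            rw [← mul_pow]; congr 1; field_simp
          rw [← this]
          ring
  -- Step 2: the count minus the volume
  have hstep2 : |(∑ n' ∈ P, (1 : ℝ)) - V| ≤ Cl * (N : ℝ) ^ (d - 1) := by
    rw [Finset.sum_const, nsmul_eq_mul, mul_one]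
    exact hLatt K hKconv hKbox
  -- combine
  rw [Finset.sum_sub_distrib]
  have : ∑ n' ∈ P, ∏ j ∈ T, gtPreMeasure χ γ N w b ((cellForm N N' (Φ j) a (κ j)).eval n') - ∑ n' ∈ P, (1 : ℝ) =
      (∑ n' ∈ P, ∏ j ∈ T, gtPreMeasure χ γ N w b ((cellForm N N' (Φ j) a (κ j)).eval n') - V) -
        ((∑ n' ∈ P, (1 : ℝ)) - V) := by ring
  rw [this]
  exact (abs_sub _ _).trans (add_le_add hstep1 hstep2)

open Classical in
/-- **One lift pattern, all cells**: for `s ≥ 1` unwrapped forms and a lift pattern `κ`,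
`|∑_{n ∈ [0,N')^d} ∏_j δ(φ_j(n) - κ_j N')| ≤ #cells · (max(1, c^{-D}) ε N^d + C_d N^{d-1})`.
[cite: GreenTao2010, App. D (proof of Prop. 6.4, verification of the linear forms condition)] -/
theorem abs_sum_prod_gtDelta_lift_le {d s D L Lc N' : ℕ} (hs : 1 ≤ s) (hsD : s ≤ D) (hd : 1 ≤ d)
    (hdD : d ≤ D) (ht : 1 ≤ t) (hc : 0 < GreenTao2008.cChi χ) (hN : 1 ≤ N) (hN' : 1 ≤ N')
    (hb : ∀ i, 1 ≤ b i ∧ b i ≤ primorial w ∧ Nat.Coprime (b i) (primorial w))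
    (Φ : Fin s → AffLinForm d) (hcoeff0 : ∀ j, (Φ j).coeff ≠ 0) (hfc : IsFiniteComplexitySystem Φ)
    (hcoeff : ∀ j l, |(Φ j).coeff l| ≤ D) (κ : Fin s → ℤ)
    (hconst : ∀ a ∈ cellIndex d N N', ∀ j, |(((cellForm N N' (Φ j) a (κ j)).const : ℤ) : ℝ)| ≤ Lc * N)
    (hL : D ^ 3 + D * Lc ≤ L) {ε : ℝ} (hε : 0 ≤ ε) (hF : LinFormsEstimateAt χ γ N w D L ε)
    {Cl : ℝ} (hCl : 0 ≤ Cl) (hLatt : ∀ K : Set (Fin d → ℝ), Convex ℝ K → K ⊆ realBox d N →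
      |(#((latticeBox d N).filter fun n => realPoint n ∈ K) : ℝ) - (MeasureTheory.volume K).toReal| ≤
        Cl * (N : ℝ) ^ (d - 1)) :
    |∑ n ∈ intBox d N', ∏ j, gtDelta χ γ N w b ((Φ j).eval n - κ j * N')| ≤
      #(cellIndex d N N') * (max 1 ((1 / GreenTao2008.cChi χ) ^ D) * ε * (N : ℝ) ^ d + Cl * (N : ℝ) ^ (d - 1)) := by
  set cmax : ℝ := max 1 ((1 / GreenTao2008.cChi χ) ^ D) with hcmax
  have hcmax0 : 0 ≤ cmax := le_trans zero_le_one (le_max_left _ _)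
  set B : ℝ := cmax * ε * (N : ℝ) ^ d + Cl * (N : ℝ) ^ (d - 1) with hB
  have hB0 : 0 ≤ B := by
    rw [hB]
    exact add_nonneg (mul_nonneg (mul_nonneg hcmax0 hε) (pow_nonneg (Nat.cast_nonneg N) _))
      (mul_nonneg hCl (pow_nonneg (Nat.cast_nonneg N) _))
  refine (abs_sum_prod_gtDelta_le (χ := χ) (γ := γ) (N := N) (w := w) (b := b) hs Φ κ).trans ?_
  -- each subset of weight factors
  have hT : ∀ T ∈ (Finset.univ : Finset (Fin s)).powerset,
      |∑ n ∈ goodBox d N' N Φ κ, (∏ j ∈ T, gtPreMeasure χ γ N w b ((Φ j).eval n - κ j * N') - 1)| ≤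
        #(cellIndex d N N') * B := by
    intro T _
    rw [sum_goodBox_eq_sum_cells hN hN' Φ κ]
    have hcell : ∀ a ∈ cellIndex d N N',
        |∑ n' ∈ (latticeBox d N).filter (fun n' => realPoint n' ∈ cellBody d N N' Φ κ a),
          (∏ j ∈ T, gtPreMeasure χ γ N w b ((Φ j).eval (fun l => a l * N + n' l) - κ j * N') - 1)| ≤ B := by
      intro a ha
      rcases T.eq_empty_or_nonempty with hTe | hTne
      · rw [hTe]
        simp only [Finset.prod_empty, sub_self, Finset.sum_const_zero, abs_zero]
        exact hB0
      · have hTD : #T ≤ D := (Finset.card_le_univ T).trans (by rw [Fintype.card_fin]; exact hsD)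
        simp_rw [← cellForm_eval]
        refine (abs_sum_cell_le hd hdD ht hc hN hb Φ hcoeff0 hfc hcoeff κ a (hconst a ha) hL hF hLatt T hTne
          hTD).trans ?_
        rw [hB]
        refine add_le_add (mul_le_mul_of_nonneg_right (mul_le_mul_of_nonneg_right ?_ hε) (by positivity)) le_rfl
        rw [hcmax]
        rcases le_or_gt (1 / GreenTao2008.cChi χ) 1 with h1 | h1
        · exact (pow_le_one₀ (by positivity) h1).trans (le_max_left _ _)
        · exact (pow_le_pow_right₀ h1.le hTD).trans (le_max_right _ _)
    calc |∑ a ∈ cellIndex d N N', ∑ n' ∈ (latticeBox d N).filter (fun n' => realPoint n' ∈ cellBody d N N' Φ κ a),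
          (∏ j ∈ T, gtPreMeasure χ γ N w b ((Φ j).eval (fun l => a l * N + n' l) - κ j * N') - 1)|
        ≤ ∑ a ∈ cellIndex d N N', |∑ n' ∈ (latticeBox d N).filter (fun n' => realPoint n' ∈ cellBody d N N' Φ κ a),
          (∏ j ∈ T, gtPreMeasure χ γ N w b ((Φ j).eval (fun l => a l * N + n' l) - κ j * N') - 1)| :=
          Finset.abs_sum_le_sum_abs _ _
      _ ≤ ∑ a ∈ cellIndex d N N', B := Finset.sum_le_sum hcell
      _ = #(cellIndex d N N') * B := by rw [Finset.sum_const, nsmul_eq_mul]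
  calc (1 / 2 : ℝ) ^ s * ∑ T ∈ (Finset.univ : Finset (Fin s)).powerset,
        |∑ n ∈ goodBox d N' N Φ κ, (∏ j ∈ T, gtPreMeasure χ γ N w b ((Φ j).eval n - κ j * N') - 1)|
      ≤ (1 / 2 : ℝ) ^ s * ∑ T ∈ (Finset.univ : Finset (Fin s)).powerset, #(cellIndex d N N') * B :=
        mul_le_mul_of_nonneg_left (Finset.sum_le_sum hT) (by positivity)
    _ = #(cellIndex d N N') * B := by
        rw [Finset.sum_const, Finset.card_powerset, Finset.card_univ, Fintype.card_fin, nsmul_eq_mul]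
        push_cast
        rw [← mul_assoc, ← mul_pow]
        norm_num

open Classical in
/-- **The linear forms average of `ν`**: for a system `Ψ` of `m ≤ D` forms on `ℤ^d`, `d ≤ D`, with
coefficients bounded by `D`, at a scale where the linear forms display and the lattice-point bound
hold,
`|𝔼_{x ∈ ℤ_{N'}^d} ∏ᵢ ν(ψᵢ(x)) - 1| ≤ 2^m (2dD + 3)^m #cells (max(1,c^{-D}) ε N^d + C_d N^{d-1}) / N'^d`.
[cite: GreenTao2010, App. D (proof of Prop. 6.4, verification of the linear forms condition)] -/
theorem abs_linearFormsAverage_gtMeasure_sub_one_le {d m D L Lc N' : ℕ} [NeZero N'] (hd : 1 ≤ d)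
    (hdD : d ≤ D) (hmD : m ≤ D) (ht : 1 ≤ t) (hc : 0 < GreenTao2008.cChi χ) (hN : 1 ≤ N) (hNN' : N < N')
    (hb : ∀ i, 1 ≤ b i ∧ b i ≤ primorial w ∧ Nat.Coprime (b i) (primorial w))
    (Ψ : Fin m → AffLinForm d) (hnd : IsNondegenerateSystem Ψ) (hfc : IsFiniteComplexitySystem Ψ)
    (hcoeff : ∀ i l, |(Ψ i).coeff l| ≤ D)
    (hconst : ∀ i, ∀ a ∈ cellIndex d N N', ∀ k ∈ liftWindow (d * D + 1) (Ψ i).const N',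
      |(((cellForm N N' (Ψ i) a k).const : ℤ) : ℝ)| ≤ Lc * N)
    (hL : D ^ 3 + D * Lc ≤ L) {ε : ℝ} (hε : 0 ≤ ε) (hF : LinFormsEstimateAt χ γ N w D L ε)
    {Cl : ℝ} (hCl : 0 ≤ Cl) (hLatt : ∀ K : Set (Fin d → ℝ), Convex ℝ K → K ⊆ realBox d N →
      |(#((latticeBox d N).filter fun n => realPoint n ∈ K) : ℝ) - (MeasureTheory.volume K).toReal| ≤
        Cl * (N : ℝ) ^ (d - 1)) :
    |linearFormsAverage (gtMeasure χ γ N w b N') Ψ - 1| ≤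
      (2 : ℝ) ^ m * (2 * (d * D + 1) + 1 : ℝ) ^ m * #(cellIndex d N N') *
        (max 1 ((1 / GreenTao2008.cChi χ) ^ D) * ε * (N : ℝ) ^ d + Cl * (N : ℝ) ^ (d - 1)) / (N' : ℝ) ^ d := by
  have hN'1 : 1 ≤ N' := by omega
  have hN'0 : 0 < N' := by omega
  have hN'r : (0 : ℝ) < (N' : ℝ) ^ d := by positivity
  set B : ℝ := max 1 ((1 / GreenTao2008.cChi χ) ^ D) * ε * (N : ℝ) ^ d + Cl * (N : ℝ) ^ (d - 1) with hB
  have hcmax0 : 0 ≤ max 1 ((1 / GreenTao2008.cChi χ) ^ D) := le_trans zero_le_one (le_max_left _ _)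
  have hB0 : 0 ≤ B := by
    rw [hB]
    exact add_nonneg (mul_nonneg (mul_nonneg hcmax0 hε) (pow_nonneg (Nat.cast_nonneg N) _))
      (mul_nonneg hCl (pow_nonneg (Nat.cast_nonneg N) _))
  set Wd : ℝ := (2 * (d * D + 1) + 1 : ℝ) with hWd
  have hWd1 : 1 ≤ Wd := by
    rw [hWd]
    have : (0 : ℝ) ≤ d * D := by positivity
    linarith
  rw [linearFormsAverage_gtMeasure_sub_one, abs_div, abs_of_pos hN'r]
  refine div_le_div_of_nonneg_right ?_ hN'r.le
  -- each non-empty subset of forms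
  have hS : ∀ S ∈ ((Finset.univ : Finset (Fin m)).powerset).erase ∅,
      |∑ n ∈ intBox d N', ∏ i ∈ S, gtDelta χ γ N w b ((Ψ i).eval n % N')| ≤ Wd ^ m * (#(cellIndex d N N') * B) := by
    intro S hS
    obtain ⟨hSne, -⟩ := Finset.mem_erase.mp hS
    set s := S.card with hs
    have hs1 : 1 ≤ s := Finset.card_pos.mpr (Finset.nonempty_iff_ne_empty.mpr hSne)
    have hsm : s ≤ m := (Finset.card_le_univ S).trans (by rw [Fintype.card_fin])
    have hsD : s ≤ D := hsm.trans hmD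
    set σ := S.orderEmbOfFin rfl with hσ
    set Φ : Fin s → AffLinForm d := fun j => Ψ (σ j) with hΦ
    have hcoeff0 : ∀ j, (Φ j).coeff ≠ 0 := fun j => hnd.1 (σ j)
    have hfcΦ : IsFiniteComplexitySystem Φ := fun j j' hjj' A Bc hAB =>
      hfc (σ j) (σ j') (fun h => hjj' (σ.injective h)) A Bc hAB
    have hcoeffΦ : ∀ j l, |(Φ j).coeff l| ≤ D := fun j l => hcoeff (σ j) l
    rw [Finset.sum_congr rfl fun n _ => prod_eq_prod_orderEmbOfFin S rfl (fun i => gtDelta χ γ N w b ((Ψ i).eval n % N')),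
      sum_prod_gtDelta_eq (χ := χ) (γ := γ) (N := N) (w := w) (b := b) hNN' hN'0 Φ hcoeffΦ]
    have hκ : ∀ κ ∈ Fintype.piFinset (fun j => liftWindow (d * D + 1) (Φ j).const N'),
        |∑ n ∈ intBox d N', ∏ j, gtDelta χ γ N w b ((Φ j).eval n - κ j * N')| ≤ #(cellIndex d N N') * B :=
      fun κ hκ => abs_sum_prod_gtDelta_lift_le hs1 hsD hd hdD ht hc hN hN'1 hb Φ hcoeff0 hfcΦ hcoeffΦ κ
        (fun a ha j => hconst (σ j) a ha (κ j) (Fintype.mem_piFinset.mp hκ j)) hL hε hF hCl hLatt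
    calc |∑ κ ∈ Fintype.piFinset (fun j => liftWindow (d * D + 1) (Φ j).const N'),
          ∑ n ∈ intBox d N', ∏ j, gtDelta χ γ N w b ((Φ j).eval n - κ j * N')|
        ≤ ∑ κ ∈ Fintype.piFinset (fun j => liftWindow (d * D + 1) (Φ j).const N'),
          |∑ n ∈ intBox d N', ∏ j, gtDelta χ γ N w b ((Φ j).eval n - κ j * N')| := Finset.abs_sum_le_sum_abs _ _
      _ ≤ ∑ κ ∈ Fintype.piFinset (fun j => liftWindow (d * D + 1) (Φ j).const N'), #(cellIndex d N N') * B :=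
          Finset.sum_le_sum hκ
      _ = Wd ^ s * (#(cellIndex d N N') * B) := by
          rw [Finset.sum_const, Fintype.card_piFinset, nsmul_eq_mul]
          simp_rw [card_liftWindow]
          rw [Finset.prod_const, Finset.card_univ, Fintype.card_fin]
          push_cast
          rw [hWd]
      _ ≤ Wd ^ m * (#(cellIndex d N N') * B) :=
          mul_le_mul_of_nonneg_right (pow_le_pow_right₀ hWd1 hsm) (by positivity)
  calc |∑ S ∈ ((Finset.univ : Finset (Fin m)).powerset).erase ∅,
        ∑ n ∈ intBox d N', ∏ i ∈ S, gtDelta χ γ N w b ((Ψ i).eval n % N')|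
      ≤ ∑ S ∈ ((Finset.univ : Finset (Fin m)).powerset).erase ∅,
        |∑ n ∈ intBox d N', ∏ i ∈ S, gtDelta χ γ N w b ((Ψ i).eval n % N')| := Finset.abs_sum_le_sum_abs _ _
    _ ≤ ∑ S ∈ ((Finset.univ : Finset (Fin m)).powerset).erase ∅, Wd ^ m * (#(cellIndex d N N') * B) :=
        Finset.sum_le_sum hS
    _ ≤ (2 : ℝ) ^ m * (Wd ^ m * (#(cellIndex d N N') * B)) := by
        rw [Finset.sum_const, nsmul_eq_mul]
        refine mul_le_mul_of_nonneg_right ?_ (by positivity)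
        have : (((Finset.univ : Finset (Fin m)).powerset).erase ∅).card ≤ 2 ^ m :=
          Finset.card_erase_le.trans (by simp)
        exact_mod_cast this
    _ = (2 : ℝ) ^ m * Wd ^ m * #(cellIndex d N N') * B := by ring

/-! ### The constants of the cells -/

/-- `#[0, A]^d = (A + 1)^d`. [folklore] -/
theorem card_cellIndex (d N N' : ℕ) : #(cellIndex d N N') = (cellCount N N' + 1) ^ d := by
  rw [cellIndex, Fintype.card_piFinset, Finset.prod_const, Finset.card_univ, Fintype.card_fin, Int.card_Icc]
  have : ((cellCount N N' : ℤ) + 1 - 0).toNat = cellCount N N' + 1 := by omega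
  rw [this]

/-- `A = ⌊(N'-1)/N⌋ ≤ 2C` for `N' ≤ 2CN`. [folklore] -/
theorem cellCount_le {N N' : ℕ} (hN : 1 ≤ N) {C : ℝ} (hN'C : (N' : ℝ) ≤ 2 * C * N) :
    (cellCount N N' : ℝ) ≤ 2 * C := by
  have hN0 : (0 : ℝ) < N := by exact_mod_cast hN
  calc (cellCount N N' : ℝ) ≤ ((N' - 1 : ℕ) : ℝ) / N := Nat.cast_div_le
    _ ≤ (N' : ℝ) / N := by
        gcongr
        exact_mod_cast Nat.sub_le N' 1
    _ ≤ 2 * C := by rw [div_le_iff₀ hN0]; linarith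

/-- `N · A ≤ N' - 1 < N'`. [folklore] -/
theorem mul_cellCount_le (N N' : ℕ) : N * cellCount N N' ≤ N' - 1 := by
  rw [cellCount, mul_comm]
  exact Nat.div_mul_le_self _ _

/-- **The constants of the shifted forms**: for a cell `a ∈ [0,A]^d` and a lift `k` in the window,
`|φ(0) + N φ̇(a) - k N'| ≤ (2dD + 2) N' ≤ (2D² + 2)(2C) N`. [folklore] -/
theorem abs_cellForm_const_le {d D N N' : ℕ} (hN : 1 ≤ N) (hN' : 1 ≤ N') (hdD : d ≤ D) {C : ℝ}
    (hN'C : (N' : ℝ) ≤ 2 * C * N) (ψ : AffLinForm d) (hcoeff : ∀ l, |ψ.coeff l| ≤ D)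
    {a : Fin d → ℤ} (ha : a ∈ cellIndex d N N') {k : ℤ} (hk : k ∈ liftWindow (d * D + 1) ψ.const N') :
    |(((cellForm N N' ψ a k).const : ℤ) : ℝ)| ≤ ((2 * D ^ 2 + 2) * (2 * ⌈C⌉₊) : ℕ) * N := by
  have hN'0 : (0 : ℤ) < N' := by exact_mod_cast hN'
  -- `|c - k N'| ≤ (dD + 2) N'`
  obtain ⟨hk1, hk2⟩ := Finset.mem_Icc.mp hk
  have hmod : ψ.const % N' = ψ.const - N' * (ψ.const / N') := Int.emod_def _ _
  have hm0 : 0 ≤ ψ.const % N' := Int.emod_nonneg _ hN'0.ne'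
  have hm1 : ψ.const % N' < N' := Int.emod_lt_of_pos _ hN'0
  have p1 : (k - (ψ.const / N' + ((d * D + 1 : ℕ) : ℤ))) * (N' : ℤ) ≤ 0 :=
    mul_nonpos_of_nonpos_of_nonneg (by linarith) hN'0.le
  have p2 : 0 ≤ (k - (ψ.const / N' - ((d * D + 1 : ℕ) : ℤ))) * (N' : ℤ) :=
    mul_nonneg (by linarith) hN'0.le
  have h1 : |ψ.const - k * N'| ≤ ((d * D + 2 : ℕ) : ℤ) * N' := by
    rw [abs_le]
    push_cast at p1 p2 ⊢
    constructor <;> nlinarith [p1, p2, hmod, hm0, hm1]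
  -- `|N φ̇(a)| ≤ dD N'`
  have ha' : ∀ l, |a l| ≤ (cellCount N N' : ℤ) := fun l => by
    obtain ⟨h0, h1⟩ := Finset.mem_Icc.mp (Fintype.mem_piFinset.mp ha l)
    rw [abs_of_nonneg h0]; exact h1
  have h2 : |(N : ℤ) * ψ.linearPart a| ≤ (d * D : ℤ) * N' := by
    rw [abs_mul, abs_of_nonneg (by positivity : (0 : ℤ) ≤ N)]
    have hl := abs_linearPart_le ψ hcoeff ha'
    have hcc : (N : ℤ) * cellCount N N' ≤ N' := by
      have := mul_cellCount_le N N'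
      have : N * cellCount N N' ≤ N' := this.trans (Nat.sub_le _ _)
      exact_mod_cast this
    calc (N : ℤ) * |ψ.linearPart a| ≤ N * (d * D * cellCount N N') :=
          mul_le_mul_of_nonneg_left hl (by positivity)
      _ = d * D * (N * cellCount N N') := by ring
      _ ≤ d * D * N' := mul_le_mul_of_nonneg_left hcc (by positivity)
  -- assemble
  have h3 : |(cellForm N N' ψ a k).const| ≤ ((2 * d * D + 2 : ℕ) : ℤ) * N' := by
    show |ψ.const + (N : ℤ) * ψ.linearPart a - k * N'| ≤ _
    have : ψ.const + (N : ℤ) * ψ.linearPart a - k * N' = (ψ.const - k * N') + (N : ℤ) * ψ.linearPart a := by ring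
    rw [this]
    refine (abs_add_le _ _).trans ?_
    push_cast at h1 ⊢
    nlinarith
  have h4 : |(((cellForm N N' ψ a k).const : ℤ) : ℝ)| ≤ ((2 * d * D + 2 : ℕ) : ℝ) * N' := by
    rw [← Int.cast_abs]; exact_mod_cast h3
  refine h4.trans ?_
  have hC : C ≤ ⌈C⌉₊ := Nat.le_ceil C
  have hd : (d : ℝ) ≤ D := by exact_mod_cast hdD
  have hN0 : (0 : ℝ) ≤ N := Nat.cast_nonneg N
  have hD0 : (0 : ℝ) ≤ D := Nat.cast_nonneg D
  push_cast
  have e1 : (2 * (d : ℝ) * D + 2) ≤ 2 * D ^ 2 + 2 := by nlinarith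
  have e2 : (N' : ℝ) ≤ 2 * ⌈C⌉₊ * N := hN'C.trans (by nlinarith)
  have e3 : (0 : ℝ) ≤ 2 * (d : ℝ) * D + 2 := by positivity
  calc (2 * (d : ℝ) * D + 2) * N' ≤ (2 * (d : ℝ) * D + 2) * (2 * ⌈C⌉₊ * N) := mul_le_mul_of_nonneg_left e2 e3
    _ ≤ (2 * (D : ℝ) ^ 2 + 2) * (2 * ⌈C⌉₊ * N) := mul_le_mul_of_nonneg_right e1 (by positivity)
    _ = (2 * (D : ℝ) ^ 2 + 2) * (2 * ⌈C⌉₊) * N := by ring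

/-! ### The linear forms condition from the linear forms display -/

/-- **The linear forms condition for Green–Tao's measure from the Goldston–Yıldırım display**
(Green–Tao 2010, App. D, proof of Prop. 6.4: "Let us first verify the `(D,D,D)`-linear forms
condition. By decomposing `ν` up into its various components as in [Green–Tao 2008], it certainly
suffices to establish the somewhat general bound `∑_{n ∈ K ∩ ℤ^d} ∏_{j ∈ [m]} ν̃(ψ_j(n)) = vol_d(K) + o(N^d)`
where … no two of which are affinely related, `m, d, ‖Ψ‖_N` are all `O_D(1)`, and `K ⊆ [-N,N]^d`
is a convex body with `Ψ(K) ⊆ [-N,N]^m`. Splitting `ν̃` up further, we thus reduce to showing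
(D.8)"). Discharges `GreenTao2010_envelopingSieve_linearFormsCondition` relative to the display
(D.8) vendored as `GreenTao2010_envelopingSieve_linearForms`, using the lattice-point count of
convex bodies (`GreenTao2010_latticePointsConvexBody_holds`, App. A) for the main terms.
[cite: GreenTao2010, App. D (proof of Prop. 6.4, verification of the linear forms condition)] -/
theorem GreenTao2010_envelopingSieve_linearFormsCondition_of_linearForms
    (hLF : GreenTao2010_envelopingSieve_linearForms) :
    GreenTao2010_envelopingSieve_linearFormsCondition := by
  classical
  intro D t hD ht C hC χ hχ hc
  have hD1 : 1 ≤ D := by omega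
  set Lc : ℕ := (2 * D ^ 2 + 2) * (2 * ⌈C⌉₊) with hLc
  set L : ℕ := D ^ 3 + D * Lc with hL
  obtain ⟨γ₀, hγ₀, H1⟩ := linFormsEstimateAt_of_linearForms hLF D L hχ
  -- lattice-point constants for `1 ≤ d ≤ D`
  have Hl : ∀ d : ℕ, ∃ Cl : ℝ, 0 ≤ Cl ∧ (1 ≤ d → ∀ N : ℕ, 1 ≤ N → ∀ K : Set (Fin d → ℝ), Convex ℝ K →
      K ⊆ realBox d N →
      |(#((latticeBox d N).filter fun n => realPoint n ∈ K) : ℝ) - (MeasureTheory.volume K).toReal| ≤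
        Cl * (N : ℝ) ^ (d - 1)) := by
    intro d
    by_cases hd : 1 ≤ d
    · obtain ⟨Cl, hCl⟩ := GreenTao2010_latticePointsConvexBody_holds d hd
      refine ⟨max Cl 0, le_max_right _ _, fun _ N hN K hK hKb => (hCl N hN K hK hKb).trans ?_⟩
      exact mul_le_mul_of_nonneg_right (le_max_left _ _) (by positivity)
    · exact ⟨0, le_rfl, fun h => absurd h hd⟩
  choose Clf hClf0 hClf using Hl
  have hne : (Finset.Icc 1 D).Nonempty := ⟨1, Finset.mem_Icc.mpr ⟨le_rfl, hD1⟩⟩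
  set Clmax : ℝ := (Finset.Icc 1 D).sup' hne Clf with hClmax
  have hClle : ∀ d, 1 ≤ d → d ≤ D → Clf d ≤ Clmax := fun d h1 h2 =>
    Finset.le_sup' Clf (Finset.mem_Icc.mpr ⟨h1, h2⟩)
  have hClmax0 : 0 ≤ Clmax := (hClf0 1).trans (hClle 1 le_rfl hD1)
  -- the constants
  set cmax : ℝ := max 1 ((1 / GreenTao2008.cChi χ) ^ D) with hcmax
  have hcmax1 : 1 ≤ cmax := le_max_left _ _
  set WD : ℝ := 2 * ((D : ℝ) * D + 1) + 1 with hWD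
  have hWD1 : 1 ≤ WD := by
    rw [hWD]
    have : (0 : ℝ) ≤ (D : ℝ) * D := by positivity
    linarith
  set M₀ : ℝ := (2 : ℝ) ^ D * WD ^ D * (2 * C + 1) ^ D with hM₀
  have hC1 : 1 ≤ 2 * C + 1 := by linarith
  have hM₀1 : 1 ≤ M₀ := by
    rw [hM₀]
    exact one_le_mul_of_one_le_of_one_le (one_le_mul_of_one_le_of_one_le (one_le_pow₀ (by norm_num))
      (one_le_pow₀ hWD1)) (one_le_pow₀ hC1)
  have hM₀0 : 0 < M₀ := by linarith
  refine ⟨γ₀, hγ₀, fun γ hγ hγle η hη => ?_⟩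
  set ε : ℝ := η / (2 * M₀ * cmax) with hε
  have hε0 : 0 < ε := by positivity
  obtain ⟨w₀, N₀, HF⟩ := H1 γ hγ hγle ε hε0
  set N₁ : ℕ := ⌈2 * M₀ * Clmax / η⌉₊ with hN₁
  refine ⟨w₀, max (max N₀ N₁) 1, fun N hN w hw hwN N' _ hN'p hCN hN'C b hb => ?_⟩
  have hN1 : 1 ≤ N := le_trans (le_max_right _ _) hN
  have hNN₀ : N₀ ≤ N := le_trans ((le_max_left _ _).trans (le_max_left _ _)) hN
  have hNN₁ : N₁ ≤ N := le_trans ((le_max_right _ _).trans (le_max_left _ _)) hN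
  have hN1r : (1 : ℝ) ≤ N := by exact_mod_cast hN1
  have hN0r : (0 : ℝ) < N := by linarith
  have hNN' : N < N' := by
    have h1 : (N : ℝ) < C * N := by nlinarith
    exact_mod_cast h1.trans_le hCN
  have hN'1 : 1 ≤ N' := by omega
  have hNlarge : 2 * M₀ * Clmax / η ≤ N := (Nat.le_ceil _).trans (by exact_mod_cast hNN₁)
  have hFN : LinFormsEstimateAt χ γ N w D L ε := HF N hNN₀ w hw hwN
  -- the linear forms condition
  intro d m hd hdD hm hmD Ψ hnd hfc hcoeffD
  have hconst : ∀ i, ∀ a ∈ cellIndex d N N', ∀ k ∈ liftWindow (d * D + 1) (Ψ i).const N',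
      |(((cellForm N N' (Ψ i) a k).const : ℤ) : ℝ)| ≤ Lc * N := fun i a ha k hk =>
    abs_cellForm_const_le hN1 hN'1 hdD hN'C (Ψ i) (hcoeffD i) ha hk
  have key := abs_linearFormsAverage_gtMeasure_sub_one_le (χ := χ) (γ := γ) (w := w) (b := b) hd hdD hmD ht hc
    hN1 hNN' hb Ψ hnd hfc hcoeffD hconst le_rfl hε0.le hFN (hClf0 d) (hClf d hd N hN1)
  refine key.trans ?_
  -- the prefactor is at most `M₀`
  have hN'pos : (0 : ℝ) < (N' : ℝ) ^ d := by positivity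
  have hNN'r : (N : ℝ) ≤ N' := by exact_mod_cast hNN'.le
  have hpre : (2 : ℝ) ^ m * (2 * (d * D + 1) + 1 : ℝ) ^ m * #(cellIndex d N N') ≤ M₀ := by
    rw [hM₀, card_cellIndex]
    push_cast
    have e1 : (2 : ℝ) ^ m ≤ (2 : ℝ) ^ D := pow_le_pow_right₀ (by norm_num) hmD
    have hWd1 : (1 : ℝ) ≤ 2 * (d * D + 1) + 1 := by
      have : (0 : ℝ) ≤ (d : ℝ) * D := by positivity
      linarith
    have hWdle : (2 * ((d : ℝ) * D + 1) + 1) ≤ WD := by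
      rw [hWD]
      have : (d : ℝ) ≤ D := by exact_mod_cast hdD
      nlinarith [Nat.cast_nonneg (α := ℝ) D]
    have e2 : (2 * ((d : ℝ) * D + 1) + 1) ^ m ≤ WD ^ D :=
      (pow_le_pow_left₀ (by linarith) hWdle m).trans (pow_le_pow_right₀ hWD1 hmD)
    have hcc : (cellCount N N' : ℝ) + 1 ≤ 2 * C + 1 := by linarith [cellCount_le hN1 hN'C]
    have e3 : ((cellCount N N' : ℝ) + 1) ^ d ≤ (2 * C + 1) ^ D :=
      (pow_le_pow_left₀ (by positivity) hcc d).trans (pow_le_pow_right₀ hC1 hdD)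
    have e12 : (2 : ℝ) ^ m * (2 * ((d : ℝ) * D + 1) + 1) ^ m ≤ (2 : ℝ) ^ D * WD ^ D :=
      mul_le_mul e1 e2 (by positivity) (by positivity)
    exact mul_le_mul e12 e3 (by positivity) (by positivity)
  -- the error is at most `cmax ε + Clmax / N`
  have herr : (cmax * ε * (N : ℝ) ^ d + Clf d * (N : ℝ) ^ (d - 1)) / (N' : ℝ) ^ d ≤ cmax * ε + Clmax / N := by
    rw [div_le_iff₀ hN'pos]
    have f1 : (N : ℝ) ^ d ≤ (N' : ℝ) ^ d := pow_le_pow_left₀ hN0r.le hNN'r d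
    have f2 : (N : ℝ) ^ (d - 1) * N = (N : ℝ) ^ d := by
      rw [← pow_succ]; congr 1; omega
    have f3 : Clf d * (N : ℝ) ^ (d - 1) ≤ Clmax / N * (N' : ℝ) ^ d := by
      calc Clf d * (N : ℝ) ^ (d - 1) ≤ Clmax * (N : ℝ) ^ (d - 1) :=
            mul_le_mul_of_nonneg_right (hClle d hd hdD) (by positivity)
        _ = Clmax / N * (N : ℝ) ^ d := by rw [← f2]; field_simp
        _ ≤ Clmax / N * (N' : ℝ) ^ d := mul_le_mul_of_nonneg_left f1 (by positivity)
    have f4 : cmax * ε * (N : ℝ) ^ d ≤ cmax * ε * (N' : ℝ) ^ d := mul_le_mul_of_nonneg_left f1 (by positivity)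
    nlinarith
  have hB0 : 0 ≤ (cmax * ε * (N : ℝ) ^ d + Clf d * (N : ℝ) ^ (d - 1)) / (N' : ℝ) ^ d := by
    have := hClf0 d
    positivity
  calc (2 : ℝ) ^ m * (2 * (d * D + 1) + 1 : ℝ) ^ m * #(cellIndex d N N') *
        (cmax * ε * (N : ℝ) ^ d + Clf d * (N : ℝ) ^ (d - 1)) / (N' : ℝ) ^ d
      = ((2 : ℝ) ^ m * (2 * (d * D + 1) + 1 : ℝ) ^ m * #(cellIndex d N N')) *
          ((cmax * ε * (N : ℝ) ^ d + Clf d * (N : ℝ) ^ (d - 1)) / (N' : ℝ) ^ d) := by ring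
    _ ≤ M₀ * (cmax * ε + Clmax / N) := mul_le_mul hpre herr hB0 hM₀0.le
    _ = η / 2 + M₀ * Clmax / N := by
        have hεM : M₀ * (cmax * ε) = η / 2 := by
          rw [hε]
          field_simp
        rw [mul_add, hεM]
        ring
    _ ≤ η / 2 + η / 2 := by
        refine add_le_add le_rfl ?_
        rw [div_le_iff₀ hN0r]
        have := (div_le_iff₀ hη).mp hNlarge
        linarith
    _ = η := by ring

end Literature.NumberTheory.Sieve

end
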